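import Summits.HodgeConjecture.HodgeConjecture.Theorems.K2E5QuatZetaMinusPrincipalPart   -- ★ R4 organs ED.1∕2 (p856103∕p856113): Φ̂(0), Φ̂ ∈ 𝒮, inversion, Γ_h-sums (+ ★ R3, ★ R0)
import Summits.HodgeConjecture.HodgeConjecture.Theorems.K2E5QuatZetaPlusBound            -- ★ R2 (p856082∕p856095, K2E5-p07): `norm_inner_le_exp`, `integrable_inner`
import Literature.MeasureTheory.Group.InvariantQuotientUnfoldingBochner                    -- ★ Weil's formula (Bochner): `fiberIntegralE`, `integral_fiberIntegralE_eq_mul_integral`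
import HarnessLib

/-!
# K2 ∕ E5 «TamagawaUnitary», unit G — R4 HEAD `K2E5QuatZetaMinusPrincipalPartHead`: the principal part of the contracting half (`hminus` of ★ R0)

Cell `hodgecm-mathlib`, item h413 = `stmt-HodgeConjecture-24833`; dealt BY NAME by the G3 lead K2E5-p07 (g0) (2026-09-04T00:19:37Z), author K2E5-p14 (g0); PROOF lane
(`--supports stmt-HodgeConjecture-24833 --as helper`).  **`quatZetaMinus_principalPart`** proves the hypothesis `hminus` of ★ R0
`K2E5QuatZetaResidueOfParts.quatZetaResidue_of_parts` BYTE FOR BYTE (anisotropic `h`, `Φ ∈ 𝒮`, `ν4 = Measure.pi ν`, bi-invariant Haar `dx¹` on `U¹`, counting measure on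
`Γ_h`), with `κ = 2`, from **the refolding identity** `quatZetaMinus_key`: `e^t (I_Φ(t) + V Φ(0)) − V Φ̂(0)∕D = D⁻¹ · I_{Φ̂}(−t)` — unfold `I_Φ(t)` over `Γ_h` (★ Weil's formula
`integral_fiberIntegralE_eq_mul_integral`, constant one; integrability ★ R2 `integrable_inner`), `Γ_h`-sums = `D_h`-sums minus the zero term (★ R4 `tsum_quatRatLatticeOne_eq`),
theta inversion ★ R3 at `x = yθ_t`, `γ ↦ γ⁻¹`, refold into `I_{Φ̂}(−t)` (★ R4 `integral_comp_inv_eq`), then ★ R2 `norm_inner_le_exp` for `Φ̂ ∈ 𝒮` (★ R4 `fourier_mem_quatSchwartzBruhat`).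
HONEST LABEL: HC_CM is proved only modulo the 7 printed citations (2 remaining named inputs: hLiu418 = stmt-HodgeConjecture-24832, h413 = stmt-HodgeConjecture-24833) until
rung 0 closes; this file is rung R4 of ONE tier-1 socket's proof ladder (G3) and discharges no socket by itself.  AUDIT: V80 p0062.txt–p0063.txt (Ch. III §2, proof of Thm. 2.2).
References: [VignerasLNM800] Ch. III §2 Thm. 2.2 · [WeilBNT1967] Ch. VII §5 Prop. 11, §6 · [TateThesis1967] §4.4 Thm. 4.4.1 · [GetzHahn2024] Thm. 3.2.2.
-/

set_option autoImplicit false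
set_option linter.dupNamespace false

noncomputable section

namespace Summit.HodgeConjecture.HodgeConjecture.Cruxes.H413.K2E5QuatZetaMinusPrincipalPartHead

open MeasureTheory Measure NumberField IsDedekindDomain Filter Topology
open Literature.MeasureTheory.Group Literature.NumberTheory Literature.NumberTheory.Automorphic
open Literature.AlgebraicGeometry.ShimuraVarieties (hermForm)
open Summit.HodgeConjecture.HodgeConjecture.Cruxes.H413.K2E5QuatAdelicMatrixModel
open Summit.HodgeConjecture.HodgeConjecture.Cruxes.H413.K2E5QuatZeta
open Summit.HodgeConjecture.HodgeConjecture.Cruxes.H413.K2E5QuatAdelicCoordinates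
open Summit.HodgeConjecture.HodgeConjecture.Cruxes.H413.K2E5QuatAdelicLattice
open Summit.HodgeConjecture.HodgeConjecture.Cruxes.H413.K2E5QuatAdelicModuleOne
open Summit.HodgeConjecture.HodgeConjecture.Cruxes.H413.K2E5QuatGramNondegenerate
open Summit.HodgeConjecture.HodgeConjecture.Cruxes.H413.K2E5QuatPoissonTransport
open Summit.HodgeConjecture.HodgeConjecture.Cruxes.H413.K2E5QuatSchwartzBruhatDilate
open Summit.HodgeConjecture.HodgeConjecture.Cruxes.H413.K2E5QuatThetaPoisson
open Summit.HodgeConjecture.HodgeConjecture.Cruxes.H413.K2E5QuatZetaMinusPrincipalPart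
open Summit.HodgeConjecture.HodgeConjecture.Cruxes.H413.K2E5QuatZetaPlusBound
open scoped Matrix MatrixGroups NNReal ENNReal

variable (L : Type) [Field L] [NumberField L] [IsCMField L] {Ha : Matrix (Fin 2) (Fin 2) L}

/-! ## §1 Module bookkeeping on `U¹ · θ` -/

/-- `|y| = 1` for `y ∈ U¹ = D^{(1)}_{h,𝔸}` (★ `mem_quatAdelicUnitsOne_iff_quatModule`). [cite: WeilBNT1967, Ch. IV §4] -/
theorem quatModule_coe_unitsOne (y : ↥(quatAdelicUnitsOne L Ha)) : quatModule L Ha (y : ↥(quatAdelicUnits L Ha)) = 1 :=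
  (mem_quatAdelicUnitsOne_iff_quatModule L Ha _).1 y.2

/-- `|(y θ_{e^t})⁻¹| = e^{−t}` for `y ∈ U¹` (as a real number). [cite: WeilBNT1967, Ch. IV §4] -/
theorem coe_quatModule_inv_mul_section (y : ↥(quatAdelicUnitsOne L Ha)) (t : ℝ) :
    ((quatModule L Ha ((y : ↥(quatAdelicUnits L Ha)) *
        quatModuleSection L Ha (Units.mk0 (Real.toNNReal (Real.exp t)) (Real.toNNReal_pos.2 (Real.exp_pos t)).ne'))⁻¹ : ℝ≥0) : ℝ) = Real.exp (-t) := by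
  rw [map_inv, map_mul, quatModule_coe_unitsOne, one_mul, quatModule_quatModuleSection, Units.val_mk0, NNReal.coe_inv,
    Real.coe_toNNReal _ (Real.exp_pos t).le, Real.exp_neg]

/-! ## §2 Summability over `D_h` and the fibre sums over `Γ_h` -/

/-- **Sums over `D_h` vs. sums over the coordinate lattice**: `ξ ↦ g(ξ ⊗ 1)` is summable over `D_h` iff `η ↦ g(quatCoord e (η ⊗ 1))` is summable over `(L⁺)⁴`
(reindexing along `quatBasis`, ★ `map_sum_smul_quatBasis_eq_quatCoord`). [folklore] -/
theorem summable_quatRat_iff (hHa : (Ha.map (cmConjRingHom L)).transpose = Ha) (hdet : Ha.det ≠ 0)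
    (g : Matrix (Fin 2) (Fin 2) (AdeleRing (𝓞 L) L) → ℝ) :
    (Summable fun ξ : ↥(quatRatSubalgebra L Ha) => g ((ξ : Matrix (Fin 2) (Fin 2) L).map (algebraMap L (AdeleRing (𝓞 L) L)))) ↔
      Summable fun η : Fin 4 → ↥(maximalRealSubfield L) =>
        g (quatCoord L (fun i => ((quatBasis L Ha hHa hdet i : ↥(quatRatSubalgebra L Ha)) : Matrix (Fin 2) (Fin 2) L))
          (fun i => algebraMap (↥(maximalRealSubfield L)) (AdeleRing (𝓞 ↥(maximalRealSubfield L)) ↥(maximalRealSubfield L)) (η i))) := by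
  have key : (fun ξ : ↥(quatRatSubalgebra L Ha) => g ((ξ : Matrix (Fin 2) (Fin 2) L).map (algebraMap L (AdeleRing (𝓞 L) L)))) ∘
      ((quatBasis L Ha hHa hdet).equivFun.symm.toEquiv : (Fin 4 → ↥(maximalRealSubfield L)) → ↥(quatRatSubalgebra L Ha)) =
      fun η : Fin 4 → ↥(maximalRealSubfield L) =>
        g (quatCoord L (fun i => ((quatBasis L Ha hHa hdet i : ↥(quatRatSubalgebra L Ha)) : Matrix (Fin 2) (Fin 2) L))
          (fun i => algebraMap (↥(maximalRealSubfield L)) (AdeleRing (𝓞 ↥(maximalRealSubfield L)) ↥(maximalRealSubfield L)) (η i))) := by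
    funext η
    rw [Function.comp_apply, LinearEquiv.coe_toEquiv, coe_equivFun_symm_quatBasis, map_sum_smul_quatBasis_eq_quatCoord]
  rw [← key]
  exact ((quatBasis L Ha hHa hdet).equivFun.symm.toEquiv.summable_iff).symm

/-- **`∑_{ξ ∈ D_h} ‖Ψ(ξ ⊗ 1)‖ < ∞` for `Ψ ∈ 𝒮(D_{h,𝔸})`** (★ `summable_norm_of_mem_piSchwartzBruhat`, reindexed). [cite: WeilBNT1967, Ch. VII §2 Prop. 2] -/
theorem summable_norm_quatRat (hHa : (Ha.map (cmConjRingHom L)).transpose = Ha) (hdet : Ha.det ≠ 0)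
    {Ψ : Matrix (Fin 2) (Fin 2) (AdeleRing (𝓞 L) L) → ℂ}
    (hΨ : Ψ ∈ quatSchwartzBruhat L (fun i => ((quatBasis L Ha hHa hdet i : ↥(quatRatSubalgebra L Ha)) : Matrix (Fin 2) (Fin 2) L))) :
    Summable fun ξ : ↥(quatRatSubalgebra L Ha) => ‖Ψ ((ξ : Matrix (Fin 2) (Fin 2) L).map (algebraMap L (AdeleRing (𝓞 L) L)))‖ := by
  have hΨ' := (mem_quatSchwartzBruhat_iff L _ Ψ).1 hΨ
  have h := summable_norm_of_mem_piSchwartzBruhat hΨ'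
  rw [summable_quatRat_iff L hHa hdet (fun m => ‖Ψ m‖)]
  exact h

section Main

variable [MeasurableSpace (AdeleRing (𝓞 ↥(maximalRealSubfield L)) ↥(maximalRealSubfield L))]
  [BorelSpace (AdeleRing (𝓞 ↥(maximalRealSubfield L)) ↥(maximalRealSubfield L))]
  (ν4 : Measure (Fin 4 → AdeleRing (𝓞 ↥(maximalRealSubfield L)) ↥(maximalRealSubfield L))) [ν4.IsAddHaarMeasure]

/-- **The dual `D_h`-sum of the theta inversion converges absolutely**: for `x ∈ (D_h ⊗ 𝔸)^×` and `Φ ∈ 𝒮`, `ξ ↦ Φ̂((ξ ⊗ 1) · x⁻¹)` has summable norms over `D_h`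
(Poisson's dual summability ★ `summable_norm_adelicPiFourier_of_mem_piSchwartzBruhat` for `Φ(x·)`, the Gram reindexing ★ `mulVec_quatGramReal_bijective`, and ★ R3
`quatFourierCoord_comp_mul_left`). [cite: VignerasLNM800, Ch. III §2] [cite: CasselsFrohlichANT1967, Ch. XV Lemma 4.2.4] -/
theorem summable_norm_fourier_mul_inv (hHa : (Ha.map (cmConjRingHom L)).transpose = Ha) (hdet : Ha.det ≠ 0) (x : ↥(quatAdelicUnits L Ha))
    {Φ : Matrix (Fin 2) (Fin 2) (AdeleRing (𝓞 L) L) → ℂ}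
    (hΦ : Φ ∈ quatSchwartzBruhat L (fun i => ((quatBasis L Ha hHa hdet i : ↥(quatRatSubalgebra L Ha)) : Matrix (Fin 2) (Fin 2) L))) :
    Summable fun ξ : ↥(quatRatSubalgebra L Ha) =>
      ‖quatFourierCoord L ν4 (quatGramReal L hdet (coe_quatBasis_mem L Ha hHa hdet))
          (fun i => ((quatBasis L Ha hHa hdet i : ↥(quatRatSubalgebra L Ha)) : Matrix (Fin 2) (Fin 2) L)) Φ
          (quatCoordInv L hHa hdet ((ξ : Matrix (Fin 2) (Fin 2) L).map (algebraMap L (AdeleRing (𝓞 L) L)) *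
            (((x⁻¹ : ↥(quatAdelicUnits L Ha)) : GL (Fin 2) (AdeleRing (𝓞 L) L)) : Matrix (Fin 2) (Fin 2) (AdeleRing (𝓞 L) L))))‖ := by
  -- Poisson's dual summability for `Φ(x·)`, reindexed by the Gram matrix
  have h0 := summable_norm_adelicPiFourier_of_mem_piSchwartzBruhat (ν := ν4)
    ((mem_quatSchwartzBruhat_iff L _ _).1 (comp_mul_left_mem_quatSchwartzBruhat L hHa hdet x hΦ))
  rw [← (Equiv.ofBijective _ (mulVec_quatGramReal_bijective L hHa hdet)).summable_iff] at h0
  have h1 : Summable fun η : Fin 4 → ↥(maximalRealSubfield L) =>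
      ‖quatFourierCoord L ν4 (quatGramReal L hdet (coe_quatBasis_mem L Ha hHa hdet))
          (fun i => ((quatBasis L Ha hHa hdet i : ↥(quatRatSubalgebra L Ha)) : Matrix (Fin 2) (Fin 2) L))
          (fun m => Φ (((x : GL (Fin 2) (AdeleRing (𝓞 L) L)) : Matrix (Fin 2) (Fin 2) (AdeleRing (𝓞 L) L)) * m))
          (fun i => algebraMap (↥(maximalRealSubfield L)) (AdeleRing (𝓞 ↥(maximalRealSubfield L)) ↥(maximalRealSubfield L)) (η i))‖ := by
    refine h0.congr fun η => ?_
    rw [Function.comp_apply, Equiv.ofBijective_apply, quatFourierCoord_algebraMap]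
  -- `(Φ(x·))̂(η ⊗ 1) = |x⁻¹| Φ̂((η ⊗ 1)·x⁻¹)` and `|x⁻¹| ≠ 0`
  have hc : ((quatModule L Ha x⁻¹ : ℝ≥0) : ℝ) ≠ 0 := (quatModule_pos L Ha x⁻¹).ne'
  have h2 : Summable fun η : Fin 4 → ↥(maximalRealSubfield L) =>
      ‖quatFourierCoord L ν4 (quatGramReal L hdet (coe_quatBasis_mem L Ha hHa hdet))
          (fun i => ((quatBasis L Ha hHa hdet i : ↥(quatRatSubalgebra L Ha)) : Matrix (Fin 2) (Fin 2) L)) Φ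
          (quatCoordInv L hHa hdet (quatCoord L (fun i => ((quatBasis L Ha hHa hdet i : ↥(quatRatSubalgebra L Ha)) : Matrix (Fin 2) (Fin 2) L))
              (fun i => algebraMap (↥(maximalRealSubfield L)) (AdeleRing (𝓞 ↥(maximalRealSubfield L)) ↥(maximalRealSubfield L)) (η i)) *
            (((x⁻¹ : ↥(quatAdelicUnits L Ha)) : GL (Fin 2) (AdeleRing (𝓞 L) L)) : Matrix (Fin 2) (Fin 2) (AdeleRing (𝓞 L) L))))‖ := by
    have h1' := h1.mul_left (((quatModule L Ha x⁻¹ : ℝ≥0) : ℝ))⁻¹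
    refine h1'.congr fun η => ?_
    rw [quatFourierCoord_comp_mul_left L ν4 hHa hdet x Φ, norm_mul, Complex.norm_real, NNReal.norm_eq,
      ← mul_assoc, inv_mul_cancel₀ hc, one_mul]
  rw [summable_quatRat_iff L hHa hdet (fun m => ‖quatFourierCoord L ν4 (quatGramReal L hdet (coe_quatBasis_mem L Ha hHa hdet))
    (fun i => ((quatBasis L Ha hHa hdet i : ↥(quatRatSubalgebra L Ha)) : Matrix (Fin 2) (Fin 2) L)) Φ
    (quatCoordInv L hHa hdet (m * (((x⁻¹ : ↥(quatAdelicUnits L Ha)) : GL (Fin 2) (AdeleRing (𝓞 L) L)) : Matrix (Fin 2) (Fin 2) (AdeleRing (𝓞 L) L))))‖)]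
  exact h2

omit [MeasurableSpace (AdeleRing (𝓞 ↥(maximalRealSubfield L)) ↥(maximalRealSubfield L))]
  [BorelSpace (AdeleRing (𝓞 ↥(maximalRealSubfield L)) ↥(maximalRealSubfield L))] in
/-- **Summability over `Γ_h` from summability over `D_h`**: `γ ↦ g(γ)` is summable over `Γ_h` whenever `ξ ↦ g(ξ ⊗ 1)` is summable over `D_h`
(`Γ_h ↪ D_h ∖ {0}`, ★ R4 `exists_coe_eq_map_of_mem_quatRatLatticeOne`; Mathlib `Summable.comp_injective`). [folklore] -/
theorem summable_quatRatLatticeOne_of_summable_quatRat (g : Matrix (Fin 2) (Fin 2) (AdeleRing (𝓞 L) L) → ℝ)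
    (hg : Summable fun ξ : ↥(quatRatSubalgebra L Ha) => g ((ξ : Matrix (Fin 2) (Fin 2) L).map (algebraMap L (AdeleRing (𝓞 L) L)))) :
    Summable fun γ : ↥(quatRatLatticeOne L Ha) =>
      g ((((γ : ↥(quatAdelicUnitsOne L Ha)) : ↥(quatAdelicUnits L Ha)) : GL (Fin 2) (AdeleRing (𝓞 L) L)) : Matrix (Fin 2) (Fin 2) (AdeleRing (𝓞 L) L)) := by
  classical
  let ι : ↥(quatRatLatticeOne L Ha) → ↥(quatRatSubalgebra L Ha) := fun γ => Classical.choose (exists_coe_eq_map_of_mem_quatRatLatticeOne L γ)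
  have hι : ∀ γ : ↥(quatRatLatticeOne L Ha),
      ((((γ : ↥(quatAdelicUnitsOne L Ha)) : ↥(quatAdelicUnits L Ha)) : GL (Fin 2) (AdeleRing (𝓞 L) L)) : Matrix (Fin 2) (Fin 2) (AdeleRing (𝓞 L) L)) =
        ((ι γ : ↥(quatRatSubalgebra L Ha)) : Matrix (Fin 2) (Fin 2) L).map (algebraMap L (AdeleRing (𝓞 L) L)) := fun γ =>
    (Classical.choose_spec (exists_coe_eq_map_of_mem_quatRatLatticeOne L γ)).2
  have hinj : Function.Injective ι := by
    intro γ γ' h; have hm : ((((γ : ↥(quatAdelicUnitsOne L Ha)) : ↥(quatAdelicUnits L Ha)) : GL (Fin 2) (AdeleRing (𝓞 L) L)) : Matrix (Fin 2) (Fin 2) (AdeleRing (𝓞 L) L)) =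
        ((((γ' : ↥(quatAdelicUnitsOne L Ha)) : ↥(quatAdelicUnits L Ha)) : GL (Fin 2) (AdeleRing (𝓞 L) L)) : Matrix (Fin 2) (Fin 2) (AdeleRing (𝓞 L) L)) := by
      rw [hι, hι, h]
    exact Subtype.ext (Subtype.ext (Subtype.ext (Units.ext hm)))
  refine (hg.comp_injective hinj).congr fun γ => ?_
  rw [Function.comp_apply, ← hι]

variable [MeasurableSpace (GL (Fin 2) (AdeleRing (𝓞 L) L))] [BorelSpace (GL (Fin 2) (AdeleRing (𝓞 L) L))]
  [MeasurableSpace (↥(quatAdelicUnitsOne L Ha) ⧸ quatRatLatticeOne L Ha)] [BorelSpace (↥(quatAdelicUnitsOne L Ha) ⧸ quatRatLatticeOne L Ha)]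
  [LocallyCompactSpace ↥(quatAdelicUnitsOne L Ha)] [SecondCountableTopology ↥(quatAdelicUnitsOne L Ha)] [T2Space ↥(quatAdelicUnitsOne L Ha)]

set_option synthInstance.maxHeartbeats 400000 in
set_option maxHeartbeats 3200000 in
/-- **THE REFOLDING IDENTITY `e^t (I_Φ(t) + V Φ(0)) − V Φ̂(0)∕D = D⁻¹ · I_{Φ̂}(−t)`** for every real `t` (`V = covol(U¹ ∕ Γ_h, dx¹)`, `D = ν4(F)`,
`Φ̂ = m ↦ quatFourierCoord L ν4 G e Φ (quatCoordInv m)`): Weil unfolding over `Γ_h` (constant one), `Γ_h`-sums = `D_h`-sums minus the zero term, theta inversion ★ R3 at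
`x = yθ_t` (`|x| = e^t`), `γ ↦ γ⁻¹`, refolding. [cite: VignerasLNM800, Ch. III §2 Thm. 2.2 (proof)] [cite: WeilBNT1967, Ch. VII §6] [cite: TateThesis1967, §4.4] -/
theorem quatZetaMinus_key (hHa : (Ha.map (cmConjRingHom L)).transpose = Ha) (hdet : Ha.det ≠ 0)
    (hanis : ∀ v : Fin 2 → L, hermForm (cmConjRingHom L) Ha v v = 0 → v = 0)
    (dx1 : Measure ↥(quatAdelicUnitsOne L Ha)) [dx1.IsHaarMeasure] [dx1.IsMulRightInvariant]
    [(count : Measure ↥(quatRatLatticeOne L Ha)).IsHaarMeasure]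
    {Φ : Matrix (Fin 2) (Fin 2) (AdeleRing (𝓞 L) L) → ℂ}
    (hΦ : Φ ∈ quatSchwartzBruhat L (fun i => ((quatBasis L Ha hHa hdet i : ↥(quatRatSubalgebra L Ha)) : Matrix (Fin 2) (Fin 2) L))) (t : ℝ) :
    (Real.exp t : ℂ) *
        ((∫ y : ↥(quatAdelicUnitsOne L Ha), Φ ((((y : ↥(quatAdelicUnits L Ha)) *
            quatModuleSection L Ha (Units.mk0 (Real.toNNReal (Real.exp t)) (Real.toNNReal_pos.2 (Real.exp_pos t)).ne') : ↥(quatAdelicUnits L Ha)) :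
              GL (Fin 2) (AdeleRing (𝓞 L) L)) : Matrix (Fin 2) (Fin 2) (AdeleRing (𝓞 L) L)) ∂dx1) +
          (((quotientMeasure (quatRatLatticeOne L Ha) (count : Measure ↥(quatRatLatticeOne L Ha)) (isClosed_quatRatLatticeOne L Ha) dx1)
              Set.univ).toReal : ℂ) * Φ 0) -
        (((quotientMeasure (quatRatLatticeOne L Ha) (count : Measure ↥(quatRatLatticeOne L Ha)) (isClosed_quatRatLatticeOne L Ha) dx1)
              Set.univ).toReal : ℂ) *
            (∫ a, Φ (quatCoord L (fun i => ((quatBasis L Ha hHa hdet i : ↥(quatRatSubalgebra L Ha)) : Matrix (Fin 2) (Fin 2) L)) a) ∂ν4) /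
            ((ν4 (piFundamentalDomain (↥(maximalRealSubfield L)) (Fin 4))).toReal : ℂ) =
      (((ν4 (piFundamentalDomain (↥(maximalRealSubfield L)) (Fin 4))).toReal⁻¹ : ℝ) : ℂ) *
        ∫ u : ↥(quatAdelicUnitsOne L Ha), quatFourierCoord L ν4 (quatGramReal L hdet (coe_quatBasis_mem L Ha hHa hdet))
          (fun i => ((quatBasis L Ha hHa hdet i : ↥(quatRatSubalgebra L Ha)) : Matrix (Fin 2) (Fin 2) L)) Φ
          (quatCoordInv L hHa hdet ((((u : ↥(quatAdelicUnits L Ha)) *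
            quatModuleSection L Ha (Units.mk0 (Real.toNNReal (Real.exp (-t))) (Real.toNNReal_pos.2 (Real.exp_pos (-t))).ne') : ↥(quatAdelicUnits L Ha)) :
              GL (Fin 2) (AdeleRing (𝓞 L) L)) : Matrix (Fin 2) (Fin 2) (AdeleRing (𝓞 L) L))) ∂dx1 := by
  classical
  have hΦh := fourier_mem_quatSchwartzBruhat L ν4 hHa hdet hΦ
  have hInt := integrable_inner L hHa hdet hanis dx1 hΦ t
  have hInt' := integrable_inner L hHa hdet hanis dx1 hΦh (-t)
  have hcont := K2E5QuatZetaAbsConvReduction.continuous_testFunction_restrict L hHa hdet hΦ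
  have hcont' := K2E5QuatZetaAbsConvReduction.continuous_testFunction_restrict L hHa hdet hΦh
  have hθC : quatModuleSection L Ha (Units.mk0 (Real.toNNReal (Real.exp (-t))) (Real.toNNReal_pos.2 (Real.exp_pos (-t))).ne') =
      (quatModuleSection L Ha (Units.mk0 (Real.toNNReal (Real.exp t)) (Real.toNNReal_pos.2 (Real.exp_pos t)).ne'))⁻¹ := by
    rw [← map_inv, ← mk0_exp_neg]
  have hcommC : ∀ u : ↥(quatAdelicUnits L Ha),
      quatModuleSection L Ha (Units.mk0 (Real.toNNReal (Real.exp t)) (Real.toNNReal_pos.2 (Real.exp_pos t)).ne') * u =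
        u * quatModuleSection L Ha (Units.mk0 (Real.toNNReal (Real.exp t)) (Real.toNNReal_pos.2 (Real.exp_pos t)).ne') :=
    fun u => quatModuleSection_mul_comm L Ha _ u
  have hinvC : ∀ u : ↥(quatAdelicUnits L Ha),
      (u * quatModuleSection L Ha (Units.mk0 (Real.toNNReal (Real.exp t)) (Real.toNNReal_pos.2 (Real.exp_pos t)).ne'))⁻¹ =
        u⁻¹ * (quatModuleSection L Ha (Units.mk0 (Real.toNNReal (Real.exp t)) (Real.toNNReal_pos.2 (Real.exp_pos t)).ne'))⁻¹ := by
    intro u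
    rw [mul_quatModuleSection_inv, map_inv]
  have hmodC : ∀ y : ↥(quatAdelicUnitsOne L Ha), (((quatModule L Ha ((y : ↥(quatAdelicUnits L Ha)) *
      quatModuleSection L Ha (Units.mk0 (Real.toNNReal (Real.exp t)) (Real.toNNReal_pos.2 (Real.exp_pos t)).ne'))⁻¹ : ℝ≥0) : ℝ) : ℂ) =
        (Real.exp (-t) : ℂ) := fun y => by rw [coe_quatModule_inv_mul_section]
  generalize hgt : quatModuleSection L Ha (Units.mk0 (Real.toNNReal (Real.exp t)) (Real.toNNReal_pos.2 (Real.exp_pos t)).ne') = θt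
    at hInt hθC hcommC hinvC hmodC ⊢
  generalize hgm : quatModuleSection L Ha (Units.mk0 (Real.toNNReal (Real.exp (-t))) (Real.toNNReal_pos.2 (Real.exp_pos (-t))).ne') = θm
    at hInt' hθC ⊢
  haveI : IsClosed ((quatRatLatticeOne L Ha : Subgroup ↥(quatAdelicUnitsOne L Ha)) : Set ↥(quatAdelicUnitsOne L Ha)) := isClosed_quatRatLatticeOne L Ha
  haveI : Countable ↥(quatRatLatticeOne L Ha) := countable_quatRatLatticeOne L Ha
  haveI : DiscreteTopology ↥(quatRatLatticeOne L Ha) := discreteTopology_quatRatLatticeOne L Ha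
  haveI : T2Space ↥(quatRatLatticeOne L Ha) := inferInstance
  haveI : MeasurableSingletonClass ↥(quatRatLatticeOne L Ha) := inferInstance
  haveI : CompactSpace (↥(quatAdelicUnitsOne L Ha) ⧸ quatRatLatticeOne L Ha) := K2E5QuatUnitsOneCocompact.quatUnitsOneCocompact L Ha hHa hanis hdet
  obtain ⟨K₀⟩ := (inferInstance : Nonempty (TopologicalSpace.PositiveCompacts ↥(quatAdelicUnitsOne L Ha)))
  haveI : dx1.Regular := regular_of_isMulLeftInvariant K₀.isCompact K₀.interior_nonempty K₀.isCompact.measure_lt_top.ne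
  haveI : dx1.IsInvInvariant := K2E5DetSUUnimodularWitness.isInvInvariant_of_isMulRightInvariant dx1
  haveI : IsFiniteMeasure (quotientMeasure (quatRatLatticeOne L Ha) (count : Measure ↥(quatRatLatticeOne L Ha)) (isClosed_quatRatLatticeOne L Ha) dx1) := inferInstance
  obtain ⟨Φh, hΦh_def⟩ : ∃ Φh : Matrix (Fin 2) (Fin 2) (AdeleRing (𝓞 L) L) → ℂ, Φh = fun m => quatFourierCoord L ν4
      (quatGramReal L hdet (coe_quatBasis_mem L Ha hHa hdet)) (fun i => ((quatBasis L Ha hHa hdet i : ↥(quatRatSubalgebra L Ha)) : Matrix (Fin 2) (Fin 2) L)) Φ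
      (quatCoordInv L hHa hdet m) := ⟨_, rfl⟩
  obtain ⟨f, hf_def⟩ : ∃ f : ↥(quatAdelicUnitsOne L Ha) → ℂ, f = fun y : ↥(quatAdelicUnitsOne L Ha) =>
      Φ ((((y : ↥(quatAdelicUnits L Ha)) * θt : ↥(quatAdelicUnits L Ha)) :
      GL (Fin 2) (AdeleRing (𝓞 L) L)) : Matrix (Fin 2) (Fin 2) (AdeleRing (𝓞 L) L)) := ⟨_, rfl⟩
  obtain ⟨gh, hgh_def⟩ : ∃ gh : ↥(quatAdelicUnitsOne L Ha) → ℂ, gh = fun u : ↥(quatAdelicUnitsOne L Ha) =>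
      Φh ((((u : ↥(quatAdelicUnits L Ha)) * θm : ↥(quatAdelicUnits L Ha)) :
      GL (Fin 2) (AdeleRing (𝓞 L) L)) : Matrix (Fin 2) (Fin 2) (AdeleRing (𝓞 L) L)) := ⟨_, rfl⟩
  have hgoalI : (∫ y : ↥(quatAdelicUnitsOne L Ha), Φ ((((y : ↥(quatAdelicUnits L Ha)) * θt : ↥(quatAdelicUnits L Ha)) :
      GL (Fin 2) (AdeleRing (𝓞 L) L)) : Matrix (Fin 2) (Fin 2) (AdeleRing (𝓞 L) L)) ∂dx1) = ∫ y, f y ∂dx1 := by rw [hf_def]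
  have hgoalI' : (∫ u : ↥(quatAdelicUnitsOne L Ha), quatFourierCoord L ν4 (quatGramReal L hdet (coe_quatBasis_mem L Ha hHa hdet))
      (fun i => ((quatBasis L Ha hHa hdet i : ↥(quatRatSubalgebra L Ha)) : Matrix (Fin 2) (Fin 2) L)) Φ
      (quatCoordInv L hHa hdet ((((u : ↥(quatAdelicUnits L Ha)) * θm : ↥(quatAdelicUnits L Ha)) :
        GL (Fin 2) (AdeleRing (𝓞 L) L)) : Matrix (Fin 2) (Fin 2) (AdeleRing (𝓞 L) L))) ∂dx1) = ∫ u, gh u ∂dx1 := by rw [hgh_def, hΦh_def]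
  rw [hgoalI, hgoalI']
  have hf_int : Integrable f dx1 := by rw [hf_def]; exact hInt
  have hgh_int : Integrable gh dx1 := by rw [hgh_def, hΦh_def]; exact hInt'
  have hFh_int : Integrable (fun u => gh u⁻¹) dx1 := hgh_int.comp_inv
  have hf_meas : Measurable f := by rw [hf_def]; exact (hcont.comp (continuous_subtype_val.mul continuous_const)).measurable
  have hgh_cont : Continuous gh := by rw [hgh_def, hΦh_def]; exact hcont'.comp (continuous_subtype_val.mul continuous_const)
  have hFh_meas : Measurable (fun u => gh u⁻¹) := (hgh_cont.comp continuous_inv).measurable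
  have hc1 : unfoldingConstant (quatRatLatticeOne L Ha) (count : Measure ↥(quatRatLatticeOne L Ha))
      (quotientMeasure (quatRatLatticeOne L Ha) (count : Measure ↥(quatRatLatticeOne L Ha)) (isClosed_quatRatLatticeOne L Ha) dx1) dx1 = 1 :=
    unfoldingConstant_quotientMeasure (quatRatLatticeOne L Ha) (count : Measure ↥(quatRatLatticeOne L Ha)) dx1
  have hU1 : ∫ z, fiberIntegralE (quatRatLatticeOne L Ha) (count : Measure ↥(quatRatLatticeOne L Ha)) f z
      ∂(quotientMeasure (quatRatLatticeOne L Ha) (count : Measure ↥(quatRatLatticeOne L Ha)) (isClosed_quatRatLatticeOne L Ha) dx1) = ∫ y, f y ∂dx1 := by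
    have h := integral_fiberIntegralE_eq_mul_integral (quatRatLatticeOne L Ha) (count : Measure ↥(quatRatLatticeOne L Ha))
      (quotientMeasure (quatRatLatticeOne L Ha) (count : Measure ↥(quatRatLatticeOne L Ha)) (isClosed_quatRatLatticeOne L Ha) dx1) dx1 hf_meas hf_int
    rwa [hc1, NNReal.coe_one, Complex.ofReal_one, one_mul] at h
  have hU2 : ∫ z, fiberIntegralE (quatRatLatticeOne L Ha) (count : Measure ↥(quatRatLatticeOne L Ha)) (fun u => gh u⁻¹) z
      ∂(quotientMeasure (quatRatLatticeOne L Ha) (count : Measure ↥(quatRatLatticeOne L Ha)) (isClosed_quatRatLatticeOne L Ha) dx1) = ∫ u, gh u ∂dx1 := by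
    have h := integral_fiberIntegralE_eq_mul_integral (quatRatLatticeOne L Ha) (count : Measure ↥(quatRatLatticeOne L Ha))
      (quotientMeasure (quatRatLatticeOne L Ha) (count : Measure ↥(quatRatLatticeOne L Ha)) (isClosed_quatRatLatticeOne L Ha) dx1) dx1 hFh_meas hFh_int
    rw [hc1, NNReal.coe_one, Complex.ofReal_one, one_mul] at h
    exact h.trans (integral_comp_inv_eq L dx1 gh)
  have hfy : ∀ (y : ↥(quatAdelicUnitsOne L Ha)) (γ : ↥(quatRatLatticeOne L Ha)), f (y * γ) =
      Φ (((((y : ↥(quatAdelicUnits L Ha)) * θt : ↥(quatAdelicUnits L Ha)) : GL (Fin 2) (AdeleRing (𝓞 L) L)) : Matrix (Fin 2) (Fin 2) (AdeleRing (𝓞 L) L)) *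
        ((((γ : ↥(quatAdelicUnitsOne L Ha)) : ↥(quatAdelicUnits L Ha)) : GL (Fin 2) (AdeleRing (𝓞 L) L)) : Matrix (Fin 2) (Fin 2) (AdeleRing (𝓞 L) L))) := by
    intro y γ
    have hU : (((y * γ : ↥(quatAdelicUnitsOne L Ha)) : ↥(quatAdelicUnits L Ha)) * θt) =
        ((y : ↥(quatAdelicUnits L Ha)) * θt) * ((γ : ↥(quatAdelicUnitsOne L Ha)) : ↥(quatAdelicUnits L Ha)) := by
      rw [Subgroup.coe_mul, mul_assoc, ← hcommC, ← mul_assoc]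
    rw [hf_def]
    change Φ (((((y * γ : ↥(quatAdelicUnitsOne L Ha)) : ↥(quatAdelicUnits L Ha)) * θt : ↥(quatAdelicUnits L Ha)) : GL (Fin 2) (AdeleRing (𝓞 L) L)) :
      Matrix (Fin 2) (Fin 2) (AdeleRing (𝓞 L) L)) = _
    rw [hU, Subgroup.coe_mul, Units.val_mul]
  have hFy : ∀ (y : ↥(quatAdelicUnitsOne L Ha)) (γ : ↥(quatRatLatticeOne L Ha)), gh (y * γ)⁻¹ =
      Φh ((((((γ⁻¹ : ↥(quatRatLatticeOne L Ha)) : ↥(quatAdelicUnitsOne L Ha)) : ↥(quatAdelicUnits L Ha)) : GL (Fin 2) (AdeleRing (𝓞 L) L)) :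
          Matrix (Fin 2) (Fin 2) (AdeleRing (𝓞 L) L)) *
        (((((y : ↥(quatAdelicUnits L Ha)) * θt)⁻¹ : ↥(quatAdelicUnits L Ha)) : GL (Fin 2) (AdeleRing (𝓞 L) L)) : Matrix (Fin 2) (Fin 2) (AdeleRing (𝓞 L) L))) := by
    intro y γ
    have hU : ((((y * γ)⁻¹ : ↥(quatAdelicUnitsOne L Ha)) : ↥(quatAdelicUnits L Ha)) * θm) =
        (((γ⁻¹ : ↥(quatRatLatticeOne L Ha)) : ↥(quatAdelicUnitsOne L Ha)) : ↥(quatAdelicUnits L Ha)) * ((y : ↥(quatAdelicUnits L Ha)) * θt)⁻¹ := by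
      simp only [hinvC, hθC, mul_inv_rev, Subgroup.coe_inv, Subgroup.coe_mul, mul_assoc]
    rw [hgh_def]
    change Φh (((((((y * γ)⁻¹ : ↥(quatAdelicUnitsOne L Ha)) : ↥(quatAdelicUnits L Ha)) * θm : ↥(quatAdelicUnits L Ha))) : GL (Fin 2) (AdeleRing (𝓞 L) L)) :
      Matrix (Fin 2) (Fin 2) (AdeleRing (𝓞 L) L)) = _
    rw [hU, Subgroup.coe_mul, Units.val_mul]
  have hsum_f : ∀ y : ↥(quatAdelicUnitsOne L Ha), Summable fun γ : ↥(quatRatLatticeOne L Ha) => ‖f (y * γ)‖ := by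
    intro y
    have hmem := comp_mul_left_mem_quatSchwartzBruhat L hHa hdet ((y : ↥(quatAdelicUnits L Ha)) * θt) hΦ
    have h0 := summable_norm_quatRat L hHa hdet hmem
    have h1 := summable_quatRatLatticeOne_of_summable_quatRat L
      (fun m => ‖Φ (((((y : ↥(quatAdelicUnits L Ha)) * θt : ↥(quatAdelicUnits L Ha)) : GL (Fin 2) (AdeleRing (𝓞 L) L)) :
        Matrix (Fin 2) (Fin 2) (AdeleRing (𝓞 L) L)) * m)‖) h0
    exact h1.congr fun γ => by rw [hfy]
  have hsum_F : ∀ y : ↥(quatAdelicUnitsOne L Ha), Summable fun γ : ↥(quatRatLatticeOne L Ha) => ‖gh (y * γ)⁻¹‖ := by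
    intro y
    have h0 := summable_norm_fourier_mul_inv L ν4 hHa hdet ((y : ↥(quatAdelicUnits L Ha)) * θt) hΦ
    have h1 := summable_quatRatLatticeOne_of_summable_quatRat L
      (fun m => ‖quatFourierCoord L ν4 (quatGramReal L hdet (coe_quatBasis_mem L Ha hHa hdet))
          (fun i => ((quatBasis L Ha hHa hdet i : ↥(quatRatSubalgebra L Ha)) : Matrix (Fin 2) (Fin 2) L)) Φ
          (quatCoordInv L hHa hdet (m * (((((y : ↥(quatAdelicUnits L Ha)) * θt)⁻¹ : ↥(quatAdelicUnits L Ha)) : GL (Fin 2) (AdeleRing (𝓞 L) L)) :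
            Matrix (Fin 2) (Fin 2) (AdeleRing (𝓞 L) L))))‖) h0
    have h2 := (Equiv.inv ↥(quatRatLatticeOne L Ha)).summable_iff.2 h1
    exact h2.congr fun γ => by rw [Function.comp_apply, Equiv.inv_apply, hFy, hΦh_def]
  have hfib : ∀ (g : ↥(quatAdelicUnitsOne L Ha) → ℂ) (y : ↥(quatAdelicUnitsOne L Ha)), (Summable fun γ : ↥(quatRatLatticeOne L Ha) => ‖g (y * γ)‖) →
      fiberIntegralE (quatRatLatticeOne L Ha) (count : Measure ↥(quatRatLatticeOne L Ha)) g (QuotientGroup.mk y) =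
        ∑' γ : ↥(quatRatLatticeOne L Ha), g (y * γ) := by
    intro g y hs
    rw [fiberIntegralE_mk, integral_countable (integrable_count_iff.2 hs)]
    exact tsum_congr fun γ => by rw [measureReal_def, Measure.count_singleton, ENNReal.toReal_one, one_smul]
  have hΦh0 : Φh 0 = ∫ a, Φ (quatCoord L (fun i => ((quatBasis L Ha hHa hdet i : ↥(quatRatSubalgebra L Ha)) : Matrix (Fin 2) (Fin 2) L)) a) ∂ν4 := by
    rw [hΦh_def]; exact quatFourierCoord_quatCoordInv_zero L ν4 hHa hdet Φ
  have hPW : ∀ y : ↥(quatAdelicUnitsOne L Ha), ∑' γ : ↥(quatRatLatticeOne L Ha), f (y * γ) =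
      (((ν4 (piFundamentalDomain (↥(maximalRealSubfield L)) (Fin 4))).toReal⁻¹ : ℝ) : ℂ) * ((Real.exp (-t) : ℂ) *
        (∑' γ : ↥(quatRatLatticeOne L Ha), gh (y * γ)⁻¹ +
          ∫ a, Φ (quatCoord L (fun i => ((quatBasis L Ha hHa hdet i : ↥(quatRatSubalgebra L Ha)) : Matrix (Fin 2) (Fin 2) L)) a) ∂ν4)) - Φ 0 := by
    intro y
    have h1 := tsum_quatRatLatticeOne_eq L hanis (fun m => Φ (((((y : ↥(quatAdelicUnits L Ha)) * θt : ↥(quatAdelicUnits L Ha)) :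
      GL (Fin 2) (AdeleRing (𝓞 L) L)) : Matrix (Fin 2) (Fin 2) (AdeleRing (𝓞 L) L)) * m))
      (summable_norm_quatRat L hHa hdet (comp_mul_left_mem_quatSchwartzBruhat L hHa hdet ((y : ↥(quatAdelicUnits L Ha)) * θt) hΦ)).of_norm
    have h2 := tsum_quatRat_mul_left_eq_tsum_quatRat L ν4 hHa hdet ((y : ↥(quatAdelicUnits L Ha)) * θt) hΦ
    have h3 := tsum_quatRatLatticeOne_eq L hanis (fun m => Φh (m * (((((y : ↥(quatAdelicUnits L Ha)) * θt)⁻¹ : ↥(quatAdelicUnits L Ha)) :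
      GL (Fin 2) (AdeleRing (𝓞 L) L)) : Matrix (Fin 2) (Fin 2) (AdeleRing (𝓞 L) L))))
      (by rw [hΦh_def]; exact (summable_norm_fourier_mul_inv L ν4 hHa hdet ((y : ↥(quatAdelicUnits L Ha)) * θt) hΦ).of_norm)
    have h4 := tsum_quatRatLatticeOne_inv L (fun γ : ↥(quatRatLatticeOne L Ha) =>
      Φh (((((γ : ↥(quatAdelicUnitsOne L Ha)) : ↥(quatAdelicUnits L Ha)) : GL (Fin 2) (AdeleRing (𝓞 L) L)) : Matrix (Fin 2) (Fin 2) (AdeleRing (𝓞 L) L)) *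
        (((((y : ↥(quatAdelicUnits L Ha)) * θt)⁻¹ : ↥(quatAdelicUnits L Ha)) : GL (Fin 2) (AdeleRing (𝓞 L) L)) : Matrix (Fin 2) (Fin 2) (AdeleRing (𝓞 L) L))))
    simp only [Matrix.mul_zero, Matrix.zero_mul] at h1 h3; rw [hΦh0] at h3; have h3' := (eq_sub_iff_add_eq.1 h3).symm
    rw [tsum_congr (hfy y), h1, h2, hmodC y]
    have hfold : (∑' y' : ↥(quatRatSubalgebra L Ha), quatFourierCoord L ν4 (quatGramReal L hdet (coe_quatBasis_mem L Ha hHa hdet))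
        (fun i => ((quatBasis L Ha hHa hdet i : ↥(quatRatSubalgebra L Ha)) : Matrix (Fin 2) (Fin 2) L)) Φ
        (quatCoordInv L hHa hdet ((y' : Matrix (Fin 2) (Fin 2) L).map (algebraMap L (AdeleRing (𝓞 L) L)) *
          (((((y : ↥(quatAdelicUnits L Ha)) * θt)⁻¹ : ↥(quatAdelicUnits L Ha)) : GL (Fin 2) (AdeleRing (𝓞 L) L)) : Matrix (Fin 2) (Fin 2) (AdeleRing (𝓞 L) L))))) =
        ∑' y' : ↥(quatRatSubalgebra L Ha), Φh ((y' : Matrix (Fin 2) (Fin 2) L).map (algebraMap L (AdeleRing (𝓞 L) L)) *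
          (((((y : ↥(quatAdelicUnits L Ha)) * θt)⁻¹ : ↥(quatAdelicUnits L Ha)) : GL (Fin 2) (AdeleRing (𝓞 L) L)) : Matrix (Fin 2) (Fin 2) (AdeleRing (𝓞 L) L))) := by
      rw [hΦh_def]
    rw [hfold, h3', ← h4]; congr 4; exact tsum_congr fun γ => (hFy y γ).symm
  have hfun : fiberIntegralE (quatRatLatticeOne L Ha) (count : Measure ↥(quatRatLatticeOne L Ha)) f =
      fun z => (((ν4 (piFundamentalDomain (↥(maximalRealSubfield L)) (Fin 4))).toReal⁻¹ : ℝ) : ℂ) * ((Real.exp (-t) : ℂ) *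
        (fiberIntegralE (quatRatLatticeOne L Ha) (count : Measure ↥(quatRatLatticeOne L Ha)) (fun u => gh u⁻¹) z +
          ∫ a, Φ (quatCoord L (fun i => ((quatBasis L Ha hHa hdet i : ↥(quatRatSubalgebra L Ha)) : Matrix (Fin 2) (Fin 2) L)) a) ∂ν4)) - Φ 0 := by
    funext z
    induction z using QuotientGroup.induction_on with
    | H y => rw [hfib f y (hsum_f y), hfib (fun u => gh u⁻¹) y (hsum_F y), hPW y]
  have hG_int : Integrable (fiberIntegralE (quatRatLatticeOne L Ha) (count : Measure ↥(quatRatLatticeOne L Ha)) (fun u => gh u⁻¹))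
      (quotientMeasure (quatRatLatticeOne L Ha) (count : Measure ↥(quatRatLatticeOne L Ha)) (isClosed_quatRatLatticeOne L Ha) dx1) :=
    integrable_fiberIntegralE_of_integrable (quatRatLatticeOne L Ha) (count : Measure ↥(quatRatLatticeOne L Ha))
      (quotientMeasure (quatRatLatticeOne L Ha) (count : Measure ↥(quatRatLatticeOne L Ha)) (isClosed_quatRatLatticeOne L Ha) dx1) dx1 hFh_meas hFh_int
  have hI : ∫ y, f y ∂dx1 = (((ν4 (piFundamentalDomain (↥(maximalRealSubfield L)) (Fin 4))).toReal⁻¹ : ℝ) : ℂ) * ((Real.exp (-t) : ℂ) *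
      (∫ u, gh u ∂dx1 + (∫ a, Φ (quatCoord L (fun i => ((quatBasis L Ha hHa hdet i : ↥(quatRatSubalgebra L Ha)) : Matrix (Fin 2) (Fin 2) L)) a) ∂ν4) *
        (((quotientMeasure (quatRatLatticeOne L Ha) (count : Measure ↥(quatRatLatticeOne L Ha)) (isClosed_quatRatLatticeOne L Ha) dx1) Set.univ).toReal : ℂ))) -
      Φ 0 * (((quotientMeasure (quatRatLatticeOne L Ha) (count : Measure ↥(quatRatLatticeOne L Ha)) (isClosed_quatRatLatticeOne L Ha) dx1) Set.univ).toReal : ℂ) := by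
    rw [← hU1, hfun, integral_sub, integral_const_mul, integral_const_mul, integral_add hG_int (integrable_const _), hU2,
      integral_const, integral_const, measureReal_def, Complex.real_smul, Complex.real_smul, mul_comm _ (Φ 0)]
    · congr 3; rw [mul_comm]
    · exact ((hG_int.add (integrable_const _)).const_mul _).const_mul _
    · exact integrable_const _
  have hexp : (Real.exp t : ℂ) * (Real.exp (-t) : ℂ) = 1 := by
    rw [← Complex.ofReal_mul, ← Real.exp_add, add_neg_cancel, Real.exp_zero, Complex.ofReal_one]
  have hDinv : (((ν4 (piFundamentalDomain (↥(maximalRealSubfield L)) (Fin 4))).toReal⁻¹ : ℝ) : ℂ) =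
      (((ν4 (piFundamentalDomain (↥(maximalRealSubfield L)) (Fin 4))).toReal : ℝ) : ℂ)⁻¹ := Complex.ofReal_inv _
  rw [hI, div_eq_mul_inv, ← hDinv]
  linear_combination ((((ν4 (piFundamentalDomain (↥(maximalRealSubfield L)) (Fin 4))).toReal⁻¹ : ℝ) : ℂ) *
    (∫ u, gh u ∂dx1 + (∫ a, Φ (quatCoord L (fun i => ((quatBasis L Ha hHa hdet i : ↥(quatRatSubalgebra L Ha)) : Matrix (Fin 2) (Fin 2) L)) a) ∂ν4) *
      (((quotientMeasure (quatRatLatticeOne L Ha) (count : Measure ↥(quatRatLatticeOne L Ha)) (isClosed_quatRatLatticeOne L Ha) dx1) Set.univ).toReal : ℂ))) * hexp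

set_option synthInstance.maxHeartbeats 400000 in
set_option maxHeartbeats 1600000 in
/-- **THE PRINCIPAL PART OF THE CONTRACTING HALF — the hypothesis `hminus` of ★ R0 `K2E5QuatZetaResidueOfParts.quatZetaResidue_of_parts`, byte for byte** (`κ = 2`):
by `quatZetaMinus_key` the left side is `ν⁴(F)⁻¹‖I_{Φ̂}(−t)‖`, bounded by ★ R2 `norm_inner_le_exp` for `Φ̂ ∈ 𝒮` (★ R4 `fourier_mem_quatSchwartzBruhat`).
[cite: VignerasLNM800, Ch. III §2 Thm. 2.2 (proof)] [cite: WeilBNT1967, Ch. VII §5 Prop. 11, §6] [cite: TateThesis1967, §4.4 Main Thm. 4.4.1] -/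
theorem quatZetaMinus_principalPart (hHa : (Ha.map (cmConjRingHom L)).transpose = Ha) (hdet : Ha.det ≠ 0)
    (hanis : ∀ v : Fin 2 → L, hermForm (cmConjRingHom L) Ha v v = 0 → v = 0)
    (ν : Measure (AdeleRing (𝓞 ↥(maximalRealSubfield L)) ↥(maximalRealSubfield L))) [ν.IsAddHaarMeasure]
    (dx1 : Measure ↥(quatAdelicUnitsOne L Ha)) [dx1.IsHaarMeasure] [dx1.IsMulRightInvariant]
    [(count : Measure ↥(quatRatLatticeOne L Ha)).IsHaarMeasure]
    {Φ : Matrix (Fin 2) (Fin 2) (AdeleRing (𝓞 L) L) → ℂ}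
    (hΦ : Φ ∈ quatSchwartzBruhat L (fun i => ((quatBasis L Ha hHa hdet i : ↥(quatRatSubalgebra L Ha)) : Matrix (Fin 2) (Fin 2) L))) :
    ∃ B κ : ℝ, 0 < κ ∧ ∀ t : ℝ, t ≤ 0 → ‖(Real.exp t : ℂ) *
        ((∫ y : ↥(quatAdelicUnitsOne L Ha), Φ ((((y : ↥(quatAdelicUnits L Ha)) *
            quatModuleSection L Ha (Units.mk0 (Real.toNNReal (Real.exp t)) (Real.toNNReal_pos.2 (Real.exp_pos t)).ne') : ↥(quatAdelicUnits L Ha)) :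
              GL (Fin 2) (AdeleRing (𝓞 L) L)) : Matrix (Fin 2) (Fin 2) (AdeleRing (𝓞 L) L)) ∂dx1) +
          (((quotientMeasure (quatRatLatticeOne L Ha) (count : Measure ↥(quatRatLatticeOne L Ha)) (isClosed_quatRatLatticeOne L Ha) dx1)
              Set.univ).toReal : ℂ) * Φ 0) -
        (((quotientMeasure (quatRatLatticeOne L Ha) (count : Measure ↥(quatRatLatticeOne L Ha)) (isClosed_quatRatLatticeOne L Ha) dx1)
              Set.univ).toReal : ℂ) *
            (∫ a, Φ (quatCoord L (fun i => ((quatBasis L Ha hHa hdet i : ↥(quatRatSubalgebra L Ha)) : Matrix (Fin 2) (Fin 2) L)) a)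
                ∂(Measure.pi fun _ : Fin 4 => ν)) /
            (((Measure.pi fun _ : Fin 4 => ν) (piFundamentalDomain (↥(maximalRealSubfield L)) (Fin 4))).toReal : ℂ)‖ ≤ B * Real.exp (κ * t) := by
  haveI := locallyCompactSpace_adeleRing' (↥(maximalRealSubfield L))
  haveI := secondCountableTopology_adeleRing (↥(maximalRealSubfield L))
  haveI := t2Space_adeleRing (↥(maximalRealSubfield L))
  haveI : SigmaFinite ν := inferInstance
  haveI : (Measure.pi fun _ : Fin 4 => ν).IsAddHaarMeasure := inferInstance
  obtain ⟨B, hB⟩ := norm_inner_le_exp L hHa hdet hanis dx1 (fourier_mem_quatSchwartzBruhat L (Measure.pi fun _ : Fin 4 => ν) hHa hdet hΦ)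
  refine ⟨|((Measure.pi fun _ : Fin 4 => ν) (piFundamentalDomain (↥(maximalRealSubfield L)) (Fin 4))).toReal⁻¹| * B, 2, two_pos, fun t _ => ?_⟩
  rw [quatZetaMinus_key L (Measure.pi fun _ : Fin 4 => ν) hHa hdet hanis dx1 hΦ t, norm_mul, Complex.norm_real, Real.norm_eq_abs, mul_assoc]
  refine mul_le_mul_of_nonneg_left ?_ (abs_nonneg _)
  have h := hB (-t); rw [show (-2 : ℝ) * -t = 2 * t by ring] at h; exact h

end Main

end Summit.HodgeConjecture.HodgeConjecture.Cruxes.H413.K2E5QuatZetaMinusPrincipalPartHead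

end
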